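import Summits.KontsevichZagierPeriods.KontsevichZagierPeriods.Theorems.RootDecompRelativeModAbsoluteAngleFoldP3

/-! # `RootDecompRelativeModAbsoluteAngleFoldP4` — part 4/9 of the mechanical ≤400-line split of `af_src.lean` (sha256 2a2742458ba4dd14…)
Source: decomp-kz lens-3 g14 AngleFold.lean @5fd37862 (lint-fixed copy @30e24be4 by writer g8 per critic g6-12): ANGLE ADDITION IN FAMILIES — angleCellwiseFoldAt_one : AngleCellwiseFoldAt 1 PROVED (critic CLEARED g6-12 l.1335); --supports stmt-KontsevichZagierPeriods-30572.
Split by census-1 g10 `gen/splitlean.py`: scopes re-opened with their `open`/`variable`/`set_option` context; mathematics and declaration order unchanged. -/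

noncomputable section
open Set MeasureTheory
open Literature.NumberTheory.Transcendental Literature.ModelTheory.ExponentialFields
namespace Summit.KontsevichZagierPeriods.RootDecompRelativeModAbsolute.Rung30571.RegularisedLogLayer.CylLog.Leaf.G13
namespace AngleFold
section Subst
variable {m : ℕ}

/-- **KZ rule 2 for a fibre substitution on an arbitrary domain.** -/
theorem of_sub_of_mem_relations_of_subst (ψ ψs : (Fin (m + 1) → ℝ) → ℝ) (r r' : KZ.IntegralRep (m + 1))
    (hψ : IsSemialgebraicFunOn ℚ r.domain ψ) (hψd : ∀ z ∈ r.domain, DifferentiableAt ℝ ψ z)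
    (hψs : ∀ z ∈ r.domain, HasDerivAt (fun t : ℝ => ψ (Fin.snoc (Fin.init z) t)) (ψs z) (z (Fin.last m)))
    (hinj : ∀ z₁ ∈ r.domain, ∀ z₂ ∈ r.domain, Fin.init z₁ = Fin.init z₂ → ψ z₁ = ψ z₂ →
      z₁ (Fin.last m) = z₂ (Fin.last m))
    (hr' : r'.domain = substMap ψ '' r.domain)
    (hint : ∀ z ∈ r.domain, r.integrand z = r'.integrand (substMap ψ z) * |ψs z|) :
    KZ.of r - KZ.of r' ∈ KZ.relations := by
  obtain ⟨Φ', hderiv, hdet⟩ := subst_calculus ψ ψs r.domain hψd hψs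
  refine KZ.changeOfVariablesRel_subset_relations ⟨m + 1, r, r', substMap ψ, Φ',
    isSemialgebraicMapOn_substMap r.isSemialgebraic_domain hψ, fun z hz => (hderiv z hz).hasFDerivWithinAt,
    injOn_substMap hinj, hr', fun z hz => ?_, rfl⟩
  rw [hint z hz, hdet z hz]

/-- Integrability transport along the substitution. -/
theorem integrableOn_image_substMap_iff {D : Set (Fin (m + 1) → ℝ)} (hDm : MeasurableSet D)
    (ψ ψs : (Fin (m + 1) → ℝ) → ℝ) (hψd : ∀ z ∈ D, DifferentiableAt ℝ ψ z)
    (hψs : ∀ z ∈ D, HasDerivAt (fun t : ℝ => ψ (Fin.snoc (Fin.init z) t)) (ψs z) (z (Fin.last m)))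
    (hinj : ∀ z₁ ∈ D, ∀ z₂ ∈ D, Fin.init z₁ = Fin.init z₂ → ψ z₁ = ψ z₂ →
      z₁ (Fin.last m) = z₂ (Fin.last m)) (g : (Fin (m + 1) → ℝ) → ℝ) :
    IntegrableOn g (substMap ψ '' D) ↔ IntegrableOn (fun z => |ψs z| * g (substMap ψ z)) D := by
  obtain ⟨Φ', hderiv, hdet⟩ := subst_calculus ψ ψs D hψd hψs
  rw [integrableOn_image_iff_integrableOn_abs_det_fderiv_smul (μ := volume) hDm
    (fun z hz => (hderiv z hz).hasFDerivWithinAt) (injOn_substMap hinj) g]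
  refine integrableOn_congr_fun (fun z hz => ?_) hDm
  rw [hdet z hz, smul_eq_mul]

end Subst

/-! ### §E0 Localisation to an a.e. partition of the base (domain additivity; tree `stub_cellwiseFold` bookkeeping). -/

/-- Auxiliary step `loc` (§E0): loc. [bookkeeping] -/
theorem loc {n l N : ℕ} {σ : Set (Fin n → ℝ)} (u : Fin l → (Fin n → ℝ) → ℝ)
    (hu : ∀ j, IsSemialgebraicFunOn ℚ σ (u j))
    (A : Fin l → KZ.IntegralRep (n + 1)) (hAd : ∀ j, (A j).domain = KZlog.band σ (fun _ => 0) (u j))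
    (E : Fin N → Set (Fin n → ℝ)) (hEsa : ∀ e, IsSemialgebraic ℚ (E e)) (hEσ : ∀ e, E e ⊆ σ)
    (hdisj : Pairwise (Function.onFun Disjoint E)) (hnull : volume (σ \ ⋃ e, E e) = 0)
    (hcell : ∀ e, ∀ AE : Fin l → KZ.IntegralRep (n + 1),
      (∀ j, (AE j).domain = KZlog.band (E e) (fun _ => 0) (u j)) → (∀ j, (AE j).integrand = (A j).integrand) →
      ∑ j, KZ.of (AE j) ∈ KZ.relations) :
    ∑ j, KZ.of (A j) ∈ KZ.relations := by
  have hB : ∀ j e, IsSemialgebraic ℚ (KZlog.band (E e) (fun _ => 0) (u j)) := fun j e =>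
    KZlog.isSemialgebraic_band (saConst_zero (hEsa e)) ((hu j).mono (hEσ e) (hEsa e))
  have hsub : ∀ j e, KZlog.band (E e) (fun _ => 0) (u j) ⊆ (A j).domain := fun j e z hz => by
    rw [hAd]
    exact ⟨hEσ e hz.1, hz.2⟩
  set AE : Fin l → Fin N → KZ.IntegralRep (n + 1) := fun j e =>
    (A j).restrict _ (hB j e) (hsub j e) with hAE
  have hAEd : ∀ j e, (AE j e).domain = KZlog.band (E e) (fun _ => 0) (u j) := fun _ _ => rfl
  have hsplit : ∀ j, KZ.of (A j) - ∑ e, KZ.of (AE j e) ∈ KZ.relations := by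
    intro j
    refine KZ.of_sub_sum_of_mem_relations Finset.univ (A j) (AE j) (fun e _ => ?_)
      (fun e _ _ _ => rfl) ?_ ?_
    · rw [hAEd, sdiff_eq_empty.mpr (hsub j e)]
      exact measure_empty
    · refine measure_mono_null (fun z hz => ?_) (KZ.volume_setOf_init_mem_eq_zero hnull)
      have hz1 := hz.1
      rw [hAd] at hz1
      refine ⟨hz1.1, fun hU => hz.2 ?_⟩
      obtain ⟨e, he⟩ := mem_iUnion.1 hU
      exact mem_iUnion₂.2 ⟨e, Finset.mem_univ e, ⟨he, hz1.2⟩⟩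
    · intro e _ e' _ hne
      rw [hAEd, hAEd, KZ.band_inter_band_eq_empty (Set.disjoint_iff_inter_eq_empty.1 (hdisj hne))]
      exact measure_empty
  have hcellrel : ∀ e, ∑ j, KZ.of (AE j e) ∈ KZ.relations := fun e =>
    hcell e (fun j => AE j e) (fun j => rfl) (fun j => rfl)
  have e : ∑ j, KZ.of (A j) =
      ∑ j, (KZ.of (A j) - ∑ e, KZ.of (AE j e)) + ∑ e, ∑ j, KZ.of (AE j e) := by
    rw [Finset.sum_sub_distrib, Finset.sum_comm, sub_add_cancel]
  rw [e]
  exact KZ.relations.add_mem (AddSubgroup.sum_mem _ fun j _ => hsplit j)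
    (AddSubgroup.sum_mem _ fun c _ => hcellrel c)

/-! ### §B2 Base dimension one: coordinates, the substitution region, helpers. -/

/-- The point of `ℝ¹` with coordinate `r`. -/
def bpt (r : ℝ) : Fin 1 → ℝ := fun _ => r

/-- Auxiliary step `bpt_apply` (§B2): bpt apply. [bookkeeping] -/
@[simp] theorem bpt_apply (r : ℝ) (i : Fin 1) : bpt r i = r := rfl

/-- Auxiliary step `bpt_apply_zero` (§B2): bpt apply zero. [bookkeeping] -/
theorem bpt_apply_zero (x : Fin 1 → ℝ) : bpt (x 0) = x := by
  funext i; rw [Subsingleton.elim i 0]; rfl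

/-- Auxiliary step `init_apply_zero` (§B2): init apply zero. [bookkeeping] -/
private theorem init_apply_zero (z : Fin 2 → ℝ) : Fin.init z 0 = z 0 := rfl

/-- Auxiliary step `init_eq_bpt` (§B2): init eq bpt. [bookkeeping] -/
theorem init_eq_bpt (z : Fin 2 → ℝ) : Fin.init z = bpt (z 0) := by
  funext i; rw [Subsingleton.elim i 0]; rfl

/-- Auxiliary step `continuous_bpt` (§B2): continuous bpt. [bookkeeping] -/
theorem continuous_bpt : Continuous bpt := continuous_pi fun _ => continuous_id

/-- Auxiliary step `hasDerivAt_bpt` (§B2): has Deriv At bpt. [bookkeeping] -/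
theorem hasDerivAt_bpt (r : ℝ) : HasDerivAt bpt (Pi.single (0 : Fin 1) (1 : ℝ)) r := by
  refine hasDerivAt_pi.2 fun i => ?_
  rw [Subsingleton.elim i 0]
  convert hasDerivAt_id r using 1
  all_goals rfl

/-- The partial derivative `∂₀ u` in base dimension one. -/
def du (u : (Fin 1 → ℝ) → ℝ) (x : Fin 1 → ℝ) : ℝ := fderiv ℝ u x (Pi.single 0 1)

/-- Auxiliary step `hasDerivAt_comp_bpt` (§B2): has Deriv At comp bpt. [bookkeeping] -/
theorem hasDerivAt_comp_bpt {u : (Fin 1 → ℝ) → ℝ} {r : ℝ} (hud : DifferentiableAt ℝ u (bpt r)) :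
    HasDerivAt (fun s => u (bpt s)) (du u (bpt r)) r :=
  hud.hasFDerivAt.comp_hasDerivAt r (hasDerivAt_bpt r)

/-- Order-convexity of a subset of `ℝ¹` along the coordinate. -/
def OrdConv (T : Set (Fin 1 → ℝ)) : Prop := ∀ x ∈ T, ∀ y ∈ T, ∀ r : ℝ, x 0 ≤ r → r ≤ y 0 → bpt r ∈ T

/-- Auxiliary step `ordConv_of_convex` (§B2): ord Conv of convex. [bookkeeping] -/
theorem ordConv_of_convex {T : Set (Fin 1 → ℝ)} (hT : Convex ℝ T) : OrdConv T := by
  intro x hx y hy r hxr hry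
  rcases eq_or_lt_of_le (hxr.trans hry) with hxy | hxy
  · have : r = x 0 := le_antisymm (hxy ▸ hry) hxr
    rw [this, bpt_apply_zero]; exact hx
  · have hpos : 0 < y 0 - x 0 := by linarith
    have h := hT hx hy (a := (y 0 - r) / (y 0 - x 0)) (b := (r - x 0) / (y 0 - x 0))
      (div_nonneg (by linarith) hpos.le) (div_nonneg (by linarith) hpos.le)
      (by rw [← add_div, div_eq_one_iff_eq hpos.ne']; ring)
    convert h using 1
    funext i
    rw [Subsingleton.elim i 0]
    simp only [bpt_apply, Pi.add_apply, Pi.smul_apply, smul_eq_mul]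
    field_simp
    ring

/-- Auxiliary step `convex_preimage_bpt` (§B2): convex preimage bpt. [bookkeeping] -/
theorem convex_preimage_bpt {T : Set (Fin 1 → ℝ)} (hTc : OrdConv T) : Convex ℝ (bpt ⁻¹' T) :=
  Set.OrdConnected.convex ⟨fun a ha b hb r hr => hTc (bpt a) ha (bpt b) hb r hr.1 hr.2⟩

/-- Auxiliary step `isOpen_preimage_bpt` (§B2): is Open preimage bpt. [bookkeeping] -/
theorem isOpen_preimage_bpt {T : Set (Fin 1 → ℝ)} (hTo : IsOpen T) : IsOpen (bpt ⁻¹' T) :=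
  hTo.preimage continuous_bpt

/-- Auxiliary step `mem_preimage_bpt` (§B2): mem preimage bpt. [bookkeeping] -/
theorem mem_preimage_bpt {T : Set (Fin 1 → ℝ)} {x : Fin 1 → ℝ} (hx : x ∈ T) : x 0 ∈ bpt ⁻¹' T := by
  rw [mem_preimage, bpt_apply_zero]; exact hx

/-- Auxiliary step `exists_mem_gt` (§B2): exists mem gt. [bookkeeping] -/
theorem exists_mem_gt {T : Set (Fin 1 → ℝ)} (hTo : IsOpen T) {x : Fin 1 → ℝ} (hx : x ∈ T) :
    ∃ y ∈ T, x 0 < y 0 := by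
  have h : bpt ⁻¹' T ∈ nhds (x 0) := (isOpen_preimage_bpt hTo).mem_nhds (mem_preimage_bpt hx)
  obtain ⟨ε, hε, hball⟩ := Metric.mem_nhds_iff.1 h
  refine ⟨bpt (x 0 + ε / 2), hball ?_, by simp only [bpt_apply]; linarith⟩
  rw [Metric.mem_ball, Real.dist_eq, show x 0 + ε / 2 - x 0 = ε / 2 by ring, abs_of_pos (by linarith)]
  linarith

/-- Auxiliary step `exists_mem_lt` (§B2): exists mem lt. [bookkeeping] -/
theorem exists_mem_lt {T : Set (Fin 1 → ℝ)} (hTo : IsOpen T) {x : Fin 1 → ℝ} (hx : x ∈ T) :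
    ∃ y ∈ T, y 0 < x 0 := by
  have h : bpt ⁻¹' T ∈ nhds (x 0) := (isOpen_preimage_bpt hTo).mem_nhds (mem_preimage_bpt hx)
  obtain ⟨ε, hε, hball⟩ := Metric.mem_nhds_iff.1 h
  refine ⟨bpt (x 0 - ε / 2), hball ?_, by simp only [bpt_apply]; linarith⟩
  rw [Metric.mem_ball, Real.dist_eq, show x 0 - ε / 2 - x 0 = -(ε / 2) by ring, abs_neg, abs_of_pos (by linarith)]
  linarith

/-- Auxiliary step `strictAntiOn_of_du_neg` (§B2): strict Anti On of du neg. [bookkeeping] -/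
theorem strictAntiOn_of_du_neg {T : Set (Fin 1 → ℝ)} (hTo : IsOpen T) (hTc : OrdConv T) {u : (Fin 1 → ℝ) → ℝ}
    (hud : ∀ x ∈ T, DifferentiableAt ℝ u x) (hdu : ∀ x ∈ T, du u x < 0) :
    StrictAntiOn (fun s => u (bpt s)) (bpt ⁻¹' T) := by
  refine strictAntiOn_of_deriv_neg (convex_preimage_bpt hTc)
    (fun s hs => (hasDerivAt_comp_bpt (hud _ hs)).continuousAt.continuousWithinAt) fun s hs => ?_
  rw [(isOpen_preimage_bpt hTo).interior_eq] at hs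
  rw [(hasDerivAt_comp_bpt (hud _ hs)).deriv]
  exact hdu _ hs

/-- Auxiliary step `strictMonoOn_of_du_pos` (§B2): strict Mono On of du pos. [bookkeeping] -/
theorem strictMonoOn_of_du_pos {T : Set (Fin 1 → ℝ)} (hTo : IsOpen T) (hTc : OrdConv T) {u : (Fin 1 → ℝ) → ℝ}
    (hud : ∀ x ∈ T, DifferentiableAt ℝ u x) (hdu : ∀ x ∈ T, 0 < du u x) :
    StrictMonoOn (fun s => u (bpt s)) (bpt ⁻¹' T) := by
  refine strictMonoOn_of_deriv_pos (convex_preimage_bpt hTc)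
    (fun s hs => (hasDerivAt_comp_bpt (hud _ hs)).continuousAt.continuousWithinAt) fun s hs => ?_
  rw [(isOpen_preimage_bpt hTo).interior_eq] at hs
  rw [(hasDerivAt_comp_bpt (hud _ hs)).deriv]
  exact hdu _ hs

/-- A constant algebraic function is `ℚ`-semialgebraic. -/
theorem saConst_of_isAlgebraic {n : ℕ} {B : Set (Fin n → ℝ)} (hB : IsSemialgebraic ℚ B) {d : ℝ}
    (hd : IsAlgebraic ℚ d) : IsSemialgebraicFunOn ℚ B (fun _ => d) :=
  isSemialgebraicFunOn_const_of_isAlgebraic hB hd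

open MvPolynomial in
/-- Auxiliary step `isSemialgebraic_setOf_bpt_mem` (§B2): is Semialgebraic set Of bpt mem. [bookkeeping] -/
theorem isSemialgebraic_setOf_bpt_mem {T : Set (Fin 1 → ℝ)} (hT : IsSemialgebraic ℚ T) (i : Fin 2) :
    IsSemialgebraic ℚ {z : Fin 2 → ℝ | bpt (z i) ∈ T} := by
  have hs : {z : Fin 2 → ℝ | bpt (z i) ∈ T} =
      (fun x : Fin 2 → ℝ => fun _ : Fin 1 => aeval x (X i : MvPolynomial (Fin 2) ℚ)) ⁻¹' T := by
    ext z; simp only [mem_setOf_eq, mem_preimage, MvPolynomial.aeval_X]; rfl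
  rw [hs]
  exact hT.preimage_aeval _

/-- Auxiliary step `isSemialgebraic_initMem` (§B2): is Semialgebraic init Mem. [bookkeeping] -/
theorem isSemialgebraic_initMem {T : Set (Fin 1 → ℝ)} (hT : IsSemialgebraic ℚ T) :
    IsSemialgebraic ℚ {z : Fin 2 → ℝ | Fin.init z ∈ T} := by
  have : {z : Fin 2 → ℝ | Fin.init z ∈ T} = {z | bpt (z 0) ∈ T} := by
    ext z; rw [mem_setOf_eq, mem_setOf_eq, init_eq_bpt]
  rw [this]
  exact isSemialgebraic_setOf_bpt_mem hT 0

open MvPolynomial in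
/-- Auxiliary step `sa_comp_bpt` (§B2): sa comp bpt. [bookkeeping] -/
theorem sa_comp_bpt {T : Set (Fin 1 → ℝ)} {f : (Fin 1 → ℝ) → ℝ} (hf : IsSemialgebraicFunOn ℚ T f) (i : Fin 2) :
    IsSemialgebraicFunOn ℚ {z : Fin 2 → ℝ | bpt (z i) ∈ T} (fun z => f (bpt (z i))) := by
  have h := hf.comp_aeval (fun _ : Fin 1 => (X i : MvPolynomial (Fin 2) ℚ))
  have hs : {z : Fin 2 → ℝ | bpt (z i) ∈ T} =
      (fun x : Fin 2 → ℝ => fun _ : Fin 1 => aeval x (X i : MvPolynomial (Fin 2) ℚ)) ⁻¹' T := by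
    ext z; simp only [mem_setOf_eq, mem_preimage, MvPolynomial.aeval_X]; rfl
  rw [hs]
  exact h.congr fun z _ => by simp only [MvPolynomial.aeval_X]; rfl

/-- The arctangent kernel with a `ℚ`-sa coefficient of the base is `ℚ`-sa. -/
theorem sa_kernel {B : Set (Fin 2 → ℝ)} (hB : IsSemialgebraic ℚ B) {T : Set (Fin 1 → ℝ)}
    (hBT : B ⊆ {z | Fin.init z ∈ T}) {p : (Fin 1 → ℝ) → ℝ} (hp : IsSemialgebraicFunOn ℚ T p) :
    IsSemialgebraicFunOn ℚ B (fun z => p (Fin.init z) / (1 + z (Fin.last 1) ^ 2)) :=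
  IsSemialgebraicFunOn.div (hp.comp_init.mono hBT hB)
    ((IsSemialgebraicFunOn.add_holds ((isSemialgebraicFunOn_ratCast hB 1).congr fun _ _ => by simp)
      ((Literature.NumberTheory.Transcendental.isSemialgebraicFunOn_apply hB (Fin.last 1)).fun_pow 2)).congr
      fun _ _ => rfl)
    fun z _ => by positivity

/-- The substitution region of a half-cell: pairs `(x, ξ)` of points of `T` with `x < ξ`. -/
def Rgn (T : Set (Fin 1 → ℝ)) : Set (Fin 2 → ℝ) :=
  {z | Fin.init z ∈ T ∧ bpt (z (Fin.last 1)) ∈ T ∧ z 0 < z (Fin.last 1)}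

open MvPolynomial in
/-- Auxiliary step `isSemialgebraic_Rgn` (§B2): is Semialgebraic Rgn. [bookkeeping] -/
theorem isSemialgebraic_Rgn {T : Set (Fin 1 → ℝ)} (hT : IsSemialgebraic ℚ T) : IsSemialgebraic ℚ (Rgn T) := by
  have h3 : IsSemialgebraic ℚ {z : Fin 2 → ℝ | z 0 < z (Fin.last 1)} := by
    simpa using isSemialgebraic_setOf_eval_lt (k := ℚ) (R := ℝ) (X 0 : MvPolynomial (Fin 2) ℚ) (X (Fin.last 1))
  have : Rgn T = ({z : Fin 2 → ℝ | Fin.init z ∈ T} ∩ {z | bpt (z (Fin.last 1)) ∈ T}) ∩ {z | z 0 < z (Fin.last 1)} := by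
    ext z; simp only [Rgn, mem_setOf_eq, mem_inter_iff, and_assoc]
  rw [this]
  exact ((isSemialgebraic_initMem hT).inter (isSemialgebraic_setOf_bpt_mem hT _)).inter h3

/-- The Jacobian integrand `p(x) u'(ξ)/(1+u(ξ)²)` on the substitution region. -/
def wfun (p u : (Fin 1 → ℝ) → ℝ) (z : Fin 2 → ℝ) : ℝ :=
  p (Fin.init z) * du u (bpt (z (Fin.last 1))) / (1 + u (bpt (z (Fin.last 1))) ^ 2)

/-- Auxiliary step `sa_wfun` (§B2): sa wfun. [bookkeeping] -/
theorem sa_wfun {T : Set (Fin 1 → ℝ)} (hT : IsSemialgebraic ℚ T) (hTo : IsOpen T) {p u : (Fin 1 → ℝ) → ℝ}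
    (hp : IsSemialgebraicFunOn ℚ T p) (hu : IsSemialgebraicFunOn ℚ T u) (hud : ∀ x ∈ T, DifferentiableAt ℝ u x) :
    IsSemialgebraicFunOn ℚ (Rgn T) (wfun p u) := by
  have hRsa := isSemialgebraic_Rgn hT
  have hR2 : Rgn T ⊆ {z | bpt (z (Fin.last 1)) ∈ T} := fun z hz => hz.2.1
  have hdusa : IsSemialgebraicFunOn ℚ T (du u) := IsSemialgebraicFunOn.fderiv_apply_single hTo hu hud 0
  have hnum : IsSemialgebraicFunOn ℚ (Rgn T) (fun z => p (Fin.init z) * du u (bpt (z (Fin.last 1)))) :=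
    IsSemialgebraicFunOn.mul_holds (hp.comp_init.mono (fun z hz => hz.1) hRsa)
      ((sa_comp_bpt hdusa (Fin.last 1)).mono hR2 hRsa)
  have hden : IsSemialgebraicFunOn ℚ (Rgn T) (fun z => 1 + u (bpt (z (Fin.last 1))) ^ 2) :=
    (IsSemialgebraicFunOn.add_holds ((isSemialgebraicFunOn_ratCast hRsa 1).congr fun _ _ => by simp)
      (((sa_comp_bpt hu (Fin.last 1)).mono hR2 hRsa).fun_pow 2)).congr fun _ _ => rfl
  have h : IsSemialgebraicFunOn ℚ (Rgn T)
      (fun z => p (Fin.init z) * du u (bpt (z (Fin.last 1))) / (1 + u (bpt (z (Fin.last 1))) ^ 2)) :=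
    IsSemialgebraicFunOn.div hnum hden fun z _ => by positivity
  exact h.congr fun z _ => rfl

/-- Auxiliary step `mk_sub_eq` (§B2): mk sub eq. [bookkeeping] -/
theorem mk_sub_eq {a b : KZ.FormalRep} (h : a - b ∈ KZ.relations) : mk a = mk b := by
  rw [← sub_eq_zero, ← map_sub, mk_eq_zero_iff]; exact h

/-- `[r] + [r.neg] ∈ relations`. -/
private theorem of_add_of_neg_mem_relations {n : ℕ} (r : KZ.IntegralRep n) : KZ.of r + KZ.of r.neg ∈ KZ.relations := by
  obtain ⟨Z, hZd, hZi⟩ := KZ.exists_zeroRep r.isSemialgebraic_domain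
  have hZ : KZ.of Z ∈ KZ.relations := KZ.of_mem_relations_of_eqOn_zero Z (fun z _ => by simp [hZi])
  have h1 : KZ.of Z - KZ.of r - KZ.of r.neg ∈ KZ.relations :=
    KZ.integrandAddRel_subset_relations ⟨n, Z, r, r.neg, hZd.symm, by rw [KZ.IntegralRep.domain_neg, hZd],
      fun z _ => by simp [hZi], rfl⟩
  convert KZ.relations.sub_mem hZ h1 using 1
  abel

/-- **Infima of `ℚ`-sa functions on `ℚ`-sa subsets of the line are algebraic** (a boundary point of the `ℚ`-sa value set). -/
theorem isAlgebraic_of_order_frontier {T : Set (Fin 1 → ℝ)} (hT : IsSemialgebraic ℚ T) {u : (Fin 1 → ℝ) → ℝ}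
    (hu : IsSemialgebraicFunOn ℚ T u) {d : ℝ} (habove : ∀ x ∈ T, d < u x)
    (happ : ∀ ε > 0, ∃ x ∈ T, u x < d + ε) : IsAlgebraic ℚ d := by
  -- the swapped graph and its projection, the value set
  have hB := isSemialgebraic_setOf_bpt_mem hT (Fin.last 1)
  have hsub : IsSemialgebraicFunOn ℚ {z : Fin 2 → ℝ | bpt (z (Fin.last 1)) ∈ T}
      (fun z => z 0 - u (bpt (z (Fin.last 1)))) :=
    IsSemialgebraicFunOn.sub_holds (Literature.NumberTheory.Transcendental.isSemialgebraicFunOn_apply hB 0)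
      (sa_comp_bpt hu (Fin.last 1))
  have hG' : IsSemialgebraic ℚ {z | z ∈ {z : Fin 2 → ℝ | bpt (z (Fin.last 1)) ∈ T} ∧
      (fun z => z 0 - u (bpt (z (Fin.last 1)))) z = 0} := hsub.isSemialgebraic_sep_eq_zero
  have hD := tarski_seidenberg_real_holds (k := ℚ) hG'
  set D : Set (Fin 1 → ℝ) := (fun x : Fin (1 + 1) → ℝ => x ∘ Fin.castSucc) ''
    {z | z ∈ {z : Fin 2 → ℝ | bpt (z (Fin.last 1)) ∈ T} ∧ (fun z => z 0 - u (bpt (z (Fin.last 1)))) z = 0} with hDdef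
  have hmemD : ∀ x ∈ T, bpt (u x) ∈ D := fun x hx => by
    have h1 : (![u x, x 0] : Fin 2 → ℝ) (Fin.last 1) = x 0 := rfl
    refine ⟨![u x, x 0], ⟨?_, ?_⟩, ?_⟩
    · simp only [mem_setOf_eq, h1, bpt_apply_zero]; exact hx
    · show (![u x, x 0] : Fin 2 → ℝ) 0 - u (bpt ((![u x, x 0] : Fin 2 → ℝ) (Fin.last 1))) = 0
      rw [h1, bpt_apply_zero, Matrix.cons_val_zero, sub_self]
    · funext i
      rw [Subsingleton.elim i 0]
      rfl
  have hDmem : ∀ y ∈ D, ∃ x ∈ T, y 0 = u x := by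
    rintro y ⟨z, ⟨hzT, hz0⟩, rfl⟩
    refine ⟨bpt (z (Fin.last 1)), hzT, ?_⟩
    have hz0' : z 0 - u (bpt (z (Fin.last 1))) = 0 := hz0
    show z (Fin.castSucc 0) = _
    rw [show (Fin.castSucc 0 : Fin 2) = 0 from rfl]
    linarith
  refine isAlgebraic_of_not_mem_nhds (x := bpt d) hD (fun hmem => ?_) (fun hmem => ?_)
  · have h' : bpt ⁻¹' D ∈ nhds d := continuous_bpt.continuousAt.preimage_mem_nhds hmem
    obtain ⟨ε, hε, hball⟩ := Metric.mem_nhds_iff.1 h'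
    have hin : d - ε / 2 ∈ bpt ⁻¹' D := hball (by
      rw [Metric.mem_ball, Real.dist_eq, show d - ε / 2 - d = -(ε / 2) by ring, abs_neg, abs_of_pos (by linarith)]
      linarith)
    obtain ⟨x, hx, hxe⟩ := hDmem _ hin
    have := habove x hx
    simp only [bpt_apply] at hxe
    linarith
  · have h' : bpt ⁻¹' Dᶜ ∈ nhds d := continuous_bpt.continuousAt.preimage_mem_nhds hmem
    obtain ⟨ε, hε, hball⟩ := Metric.mem_nhds_iff.1 h'
    obtain ⟨x, hx, hux⟩ := happ ε hε
    have h1 := habove x hx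
    have hin : u x ∈ bpt ⁻¹' Dᶜ := hball (by
      rw [Metric.mem_ball, Real.dist_eq, abs_of_pos (by linarith)]; linarith)
    exact hin (hmemD x hx)

/-! ### §B3 The substitution core: an edge strictly DECREASING towards the top end of a half-cell.
`[A] = [K] − [W]` in `Q`, with `K` the constant-top monomial at the infimum `d = inf u` (an algebraic number) and
`W = ⟦Rgn T; p(x) u'(ξ)/(1+u(ξ)²)⟧` the Jacobian monomial (KZ rule 2 with `Φ(x, ξ) = (x, u ξ)`, fibrewise injective). -/

end AngleFold
end Summit.KontsevichZagierPeriods.RootDecompRelativeModAbsolute.Rung30571.RegularisedLogLayer.CylLog.Leaf.G13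
end
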